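import Literature.NumberTheory.GaloisRepresentations.ContinuousShapiroOpenCoinducedDescent
import Literature.RepresentationTheory.FiniteGroups.AdditiveInvariantExactPieces
import HarnessLib

/-!
# The Kummer pieces `0 → 𝓗ⁿ⁻¹(B)/p → 𝓗ⁿ(B[p]) → 𝓗ⁿ(B)[p] → 0` (`n ≤ 2`) of a `p`-divisible discrete
# module, read `Δ`-equivariantly in the coinduced model `𝓗ⁿ(–) = Hⁿ(G, Maps(G ⧸ W, –))`

Topic `NumberTheory/GaloisRepresentations` (continuous cochain cohomology); namespace
`Literature.NumberTheory.GaloisRepresentations` (dot notation under `ContinuousRep`).  THEOREMS ONLY (no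
definition, no named fact, no `sorry`, no instance).  The generic `ψ`-calculus it uses is
`RepresentationTheory/FiniteGroups/AdditiveInvariantExactPieces` (instance-polymorphic, see there for why).

Let `G` be a compact (locally compact) topological group, `W ⊴ G` an OPEN normal subgroup, `Δ = G ⧸ W`,
`ρ : G → Aut(B)` a continuous representation on a DISCRETE abelian group `B`, and `p : ℕ` with
`p • : B → B` SURJECTIVE (a "Kummer situation": `0 → B[p] → B →(p) B → 0` is a short exact sequence of
discrete `G`-modules, e.g. `B = E_S = 𝒪_{K_S,S}^×` for `S ⊇ S_p`, `B[p] = μ_p`).  Write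
`𝓗ⁿ(M) := Hⁿ(G, Maps(G ⧸ W, M))` for the continuous cohomology of the coinduced module
(`ContinuousRep.coindOpen`), a `ℤ[Δ]`-module through the RIGHT translations
(`ContinuousRep.coindOpenHRep`, `coindOpenInvariantsRep` in degree `0`; tree file
`ContinuousShapiroOpenCoinducedRightAction`) — by Shapiro's lemma this is `Hⁿ(W, M)` with its
`G/W`-module structure (Serre, *Corps locaux* VII §5), obtained without any conjugation action.

Reading the long exact sequence of `0 → Maps(Δ, B[p]) → Maps(Δ, B) →(p) Maps(Δ, B) → 0`
(`IsSES.coindOpenMap`; connecting maps `IsSES.δ₀`, `IsSES.δ₁` of `ContinuousCohomologyConnecting`,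
`Δ`-equivariant by `IsSES.δ₀_coindOpenInvariantsRep`, `IsSES.δ₁_coindOpenHRep`) gives the three
`Δ`-EQUIVARIANT Kummer pieces (Neukirch–Schmidt–Wingberg (1.3.2)–(1.3.3); Greenberg 2006 §3 B (5);
Milne *ADT* I §5, proof of Thm. 5.1):

* §1 the short exact sequence `0 → B[p] → B →(p) B → 0` (`exists_kummer_isSES`) and the action of
  `Maps(Δ, p•)` on `𝓗ⁿ` (`= p •`);
* §2 degree `0`: **`𝓗⁰(B[p]) ≅ 𝓗⁰(B)[p]`** (`additive_coindOpenInvariantsRep_torsionBy`), and the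
  readings `𝓗⁰(B)/p ≅ B^W/p`, `𝓗⁰(B)[p] ≅ B^W[p]` for the natural `Δ`-action on `B^W`
  (`ContinuousRep.quotientInvariants`; via `coindOpenInvariantsEquiv_rep`);
* §3 degree `1`: **`ψ(𝓗¹(B[p])) = ψ(𝓗⁰(B)/p) + ψ(𝓗¹(B)[p])`** and the finiteness of `𝓗¹(B[p])`
  from that of the outer terms;
* §4 degree `2`: **`ψ(𝓗²(B[p])) = ψ(𝓗¹(B)/p) + ψ(𝓗²(B)[p])`** and the finiteness of `𝓗²(B[p])`
  from that of the outer terms.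

Lane «TATE-EPC-TC» of cell `bsd-eis` (crux `GoodLatticeBDPValue`, stmt-BirchSwinnertonDyer-19032),
brick B8-arith ≡ B6b, generic part (α): with `G = Gal(K_S/F) ≤ G_{K,S}` open, `W = Gal(K_S/L)`,
`Δ = Gal(L/F)`, `B = E_S`, these are the equivariant identities
`[𝓗⁰(μ_p)] = [E_{L,S}[p]]`, `[𝓗¹(μ_p)] = [E_{L,S}/p] + [𝓗¹(E_S)[p]]`, `[𝓗²(μ_p)] = [𝓗¹(E_S)/p] + [𝓗²(E_S)[p]]`
of the equivariant form of Tate's global Euler–Poincaré characteristic computation.  HONEST FRAMING: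
homological algebra only; no arithmetic statement and no case of BSD is proved here.

## References
* J. Neukirch, A. Schmidt, K. Wingberg, *Cohomology of Number Fields*, 2nd ed. (2008), (1.3.2)–(1.3.3),
  I §6 (induced modules), VIII §3 (the Kummer sequence on `E_S`). [NeukirchSchmidtWingberg2008]
* R. Greenberg, *On the structure of certain Galois cohomology groups*, Doc. Math. Extra Vol. Coates
  (2006), §3 B sequence (5). [Greenberg2006]
* J. S. Milne, *Arithmetic Duality Theorems*, 2nd ed. (2006), I §5 (proof of Thm. 5.1). [MilneADT2006]
* J.-P. Serre, *Corps locaux* (1979), VII §5; *Représentations linéaires des groupes finis* (1977),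
  §15.2 Thm. 32. [SerreLocalFields1979] [SerreLinearRepresentations1977]

## Design notes
* No morphism is introduced as a definition: the inclusion `B[p] ↪ B` and `p •` enter the structural
  statements as arbitrary morphisms `ι`, `μ` with their pointwise formulas as hypotheses (as in
  `ContinuousCohomologyDivisibleSequence`), and the `ψ`-identities quantify them away.
* `[LocallyCompactSpace G]` is needed by the degree-`2` cocycle calculus of
  `ContinuousCohomologyConnecting` (and is automatic for profinite `G`).
-/

noncomputable section

open CategoryTheory Function Submodule
open scoped Pointwise

universe u

namespace Literature.NumberTheory.GaloisRepresentations

open _root_.TopRep _root_.ContRepresentation _root_.ContinuousCohomology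
open Literature.RepresentationTheory.FiniteGroups.StableLatticeReduction
  (smul_top_le_comap torsionBy_le_comap ker_le_comap_of_comm range_le_comap_of_comm subrepresentation_congr)
open Literature.RepresentationTheory.FiniteGroups.StableLatticeReduction.Int (admissible)
open Literature.RepresentationTheory.FiniteGroups.StableLatticeReduction.Admissible
  (additive_eq_of_linearEquiv additive_eq_ker_add_range)
open Literature.RepresentationTheory.FiniteGroups.StableLatticeReduction (Poly.additive_subrepresentation_eq_of_linearEquiv)



namespace ContinuousRep

variable {G : Type u} [Group G] [TopologicalSpace G] [IsTopologicalGroup G] [CompactSpace G]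
variable {B : Type u} [AddCommGroup B] [TopologicalSpace B] [DiscreteTopology B]
variable (ρ : ContinuousRep G ℤ B) (W : Subgroup G) [W.Normal] (hW : IsOpen (W : Set G)) (p : ℕ)

/-! ## §1 The Kummer sequence `0 → B[p] → B →(p) B → 0` and `Maps(Δ, p•)` on `𝓗ⁿ` -/

omit [IsTopologicalGroup G] [CompactSpace G] in
/-- **The Kummer sequence as a short exact sequence of discrete `G`-modules**: for `p •` surjective
on `B` there are morphisms `ι : B[p] → B` (the inclusion) and `μ : B → B` (`b ↦ p • b`) of the
topological representations forming an `IsSES`. [cite: NeukirchSchmidtWingberg2008, VIII §3 (the Kummer sequence on `E_S`)]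
[cite: Greenberg2006, §3 B (5)] -/
theorem exists_kummer_isSES (hdiv : Surjective fun b : B => (p : ℤ) • b) :
    ∃ (ι : (ρ.subrepresentation (torsionBy ℤ B (p : ℤ)) (torsionBy_le_comap ρ.toRepresentation (p : ℤ))).toTopRep
        ⟶ ρ.toTopRep) (μ : ρ.toTopRep ⟶ ρ.toTopRep),
      (∀ w, ι.hom w = (w : B)) ∧ (∀ b, μ.hom b = (p : ℤ) • b) ∧ IsSES ι μ := by
  let ι : (ρ.subrepresentation (torsionBy ℤ B (p : ℤ)) (torsionBy_le_comap ρ.toRepresentation (p : ℤ))).toTopRep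
      ⟶ ρ.toTopRep :=
    TopRep.ofHom ⟨(torsionBy ℤ B (p : ℤ)).subtypeL, fun g => by ext m; rfl⟩
  let μ : ρ.toTopRep ⟶ ρ.toTopRep := TopRep.ofHom
    { toLinearMap := DistribSMul.toLinearMap ℤ B (p : ℤ)
      cont := continuous_of_discreteTopology
      isIntertwining' := fun g => by
        ext d
        change (p : ℤ) • ρ g d = ρ g ((p : ℤ) • d)
        rw [(ρ g).map_smul] }
  refine ⟨ι, μ, fun _ => rfl, fun _ => rfl, ?_⟩
  exact
    { comp_eq_zero := by
        ext w
        change (p : ℤ) • ((w : torsionBy ℤ B (p : ℤ)) : B) = 0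
        exact (mem_torsionBy_iff (p : ℤ) (w : B)).1 w.2
      injective := fun a b h => Subtype.ext h
      exact_mid := fun y hy => ⟨⟨y, (mem_torsionBy_iff (p : ℤ) y).2 hy⟩, rfl⟩
      surjective := fun y => hdiv y }

omit [W.Normal] in
/-- **`Hⁿ(Maps(Δ, p•)) = p •`** on `𝓗ⁿ(B) = Hⁿ(G, Maps(G ⧸ W, B))` (`Maps(Δ, μ)` is again
`φ ↦ p • φ`, and `Hⁿ` is additive in the morphism). [cite: Greenberg2006, §3 B (5) (p. 360 L29–30)] -/
theorem cohomologyMap_coindOpenMap_smul_apply (μ : ρ.toTopRep ⟶ ρ.toTopRep)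
    (hμ : ∀ b, μ.hom b = (p : ℤ) • b) (n : ℕ) [DiscreteTopology (G ⧸ W → B)]
    (x : continuousCohomology n (ρ.coindOpen W hW).toTopRep) :
    (cohomologyMap (ρ.coindOpenMap ρ W hW μ) n).hom x = (p : ℤ) • x := by
  have h := cohomologyMap_comp_apply_of_nsmul (ρ.coindOpenMap ρ W hW μ) (𝟙 _) p
    (fun φ => funext fun y => by
      change μ.hom (φ y) = (p • φ) y
      rw [hμ, Pi.smul_apply, natCast_zsmul]) n x
  rw [cohomologyMap_id_apply, ← natCast_zsmul] at h
  exact h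

omit [W.Normal] in
/-- `Maps(Δ, μ) ∘ Maps(Δ, ι) = 0` pointwise for the Kummer morphisms.
[cite: NeukirchSchmidtWingberg2008, VIII §3] -/
theorem coindOpenMap_smul_coindOpenMap_incl_apply
    (ι : (ρ.subrepresentation (torsionBy ℤ B (p : ℤ)) (torsionBy_le_comap ρ.toRepresentation (p : ℤ))).toTopRep
      ⟶ ρ.toTopRep) (hι : ∀ w, ι.hom w = (w : B))
    (μ : ρ.toTopRep ⟶ ρ.toTopRep) (hμ : ∀ b, μ.hom b = (p : ℤ) • b)
    (φ : G ⧸ W → torsionBy ℤ B (p : ℤ)) :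
    (ρ.coindOpenMap ρ W hW μ).hom
      (((ρ.subrepresentation (torsionBy ℤ B (p : ℤ)) (torsionBy_le_comap ρ.toRepresentation (p : ℤ))).coindOpenMap
        ρ W hW ι).hom φ) = 0 := by
  funext y
  change μ.hom (ι.hom (φ y)) = 0
  rw [hι, hμ]
  exact (mem_torsionBy_iff (p : ℤ) ((φ y : torsionBy ℤ B (p : ℤ)) : B)).1 (φ y).2

omit [W.Normal] in
/-- `p` kills `𝓗ⁿ(B[p])`. [cite: SerreGaloisCohomology1997, I §2.2] -/
theorem zsmul_coindOpen_torsionBy_eq_zero (n : ℕ)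
    (x : continuousCohomology n
      (((ρ.subrepresentation (torsionBy ℤ B (p : ℤ)) (torsionBy_le_comap ρ.toRepresentation (p : ℤ))).coindOpen
        W hW).toTopRep)) : (p : ℤ) • x = 0 := by
  haveI : DiscreteTopology (G ⧸ W → torsionBy ℤ B (p : ℤ)) := discreteTopology_coindOpen W hW
  rw [natCast_zsmul]
  exact ((ρ.subrepresentation (torsionBy ℤ B (p : ℤ)) (torsionBy_le_comap ρ.toRepresentation (p : ℤ))).coindOpen
    W hW).nsmul_eq_zero_of_forall p (fun φ => natCast_smul_coindOpen_eq_zero W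
      (fun m => by
        apply Subtype.ext
        rw [coe_smul, coe_zero]
        exact (mem_torsionBy_iff (p : ℤ) (m : B)).1 m.2) φ) n x

/-! ## §2 Degree `0`: `𝓗⁰(B[p]) ≅ 𝓗⁰(B)[p]`, `𝓗⁰(B) ≅ B^W` -/

section DegreeZero

variable {A : Type*} [AddCommGroup A]
variable (ψ : ∀ ⦃X : Type u⦄ ⦃_ : AddCommGroup X⦄ ⦃_ : Module ℤ X⦄, Representation ℤ (G ⧸ W) X → A)
  (hψ : ∀ ⦃X Y Z : Type u⦄ [AddCommGroup X] [Module ℤ X] [AddCommGroup Y] [Module ℤ Y]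
    [AddCommGroup Z] [Module ℤ Z] (ρX : Representation ℤ (G ⧸ W) X) (ρY : Representation ℤ (G ⧸ W) Y)
    (ρZ : Representation ℤ (G ⧸ W) Z) (f : X →ₗ[ℤ] Y) (g : Y →ₗ[ℤ] Z),
    (∀ s x, f (ρX s x) = ρY s (f x)) → (∀ s y, g (ρY s y) = ρZ s (g y)) →
    Injective f → Surjective g → LinearMap.range f = LinearMap.ker g → Finite Y →
    (∀ y : Y, (p : ℤ) • y = 0) → ψ ρY = ψ ρX + ψ ρZ)
include hψ

/-- **`𝓗⁰(B[p]) ≅ 𝓗⁰(B)[p]` as `Δ`-modules** (`ψ`-form): the `G`-invariant functions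
`G ⧸ W → B[p]` are the `G`-invariant functions `G ⧸ W → B` killed by `p`, compatibly with the
right translations. [cite: NeukirchSchmidtWingberg2008, (1.3.2)] [cite: SerreLocalFields1979, VII §5] -/
theorem additive_coindOpenInvariantsRep_torsionBy
    [Finite (torsionBy ℤ (ρ.coindOpen W hW).toTopRep.ρ.invariants (p : ℤ))] :
    ψ ((ρ.subrepresentation (torsionBy ℤ B (p : ℤ)) (torsionBy_le_comap ρ.toRepresentation (p : ℤ))).coindOpenInvariantsRep
        W hW) =
      ψ ((ρ.coindOpenInvariantsRep W hW).subrepresentation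
        (torsionBy ℤ (ρ.coindOpen W hW).toTopRep.ρ.invariants (p : ℤ))
        (torsionBy_le_comap _ (p : ℤ))) := by
  obtain ⟨-, good_quot, hψ'⟩ := admissible ψ hψ
  set ρp := ρ.subrepresentation (torsionBy ℤ B (p : ℤ)) (torsionBy_le_comap ρ.toRepresentation (p : ℤ)) with hρp
  -- the forward map on functions and its properties
  have hinv : ∀ φ : (ρp.coindOpen W hW).toTopRep.ρ.invariants,
      (fun y => ((φ : G ⧸ W → torsionBy ℤ B (p : ℤ)) y : B)) ∈
        (ρ.coindOpen W hW).toTopRep.ρ.invariants := fun φ g => by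
    funext y
    have h := congr_fun (φ.2 g) y
    change ρp.coindOpen W hW g (φ : G ⧸ W → torsionBy ℤ B (p : ℤ)) y = _ at h
    change ρ.coindOpen W hW g _ y = _
    rw [coindOpen_apply_apply] at h ⊢
    rw [← h]
    rfl
  have htor : ∀ φ : (ρp.coindOpen W hW).toTopRep.ρ.invariants,
      (⟨_, hinv φ⟩ : (ρ.coindOpen W hW).toTopRep.ρ.invariants) ∈
        torsionBy ℤ (ρ.coindOpen W hW).toTopRep.ρ.invariants (p : ℤ) := fun φ => by
    rw [mem_torsionBy_iff]
    apply Subtype.ext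
    funext y
    change (p : ℤ) • (((φ : G ⧸ W → torsionBy ℤ B (p : ℤ)) y : B)) = 0
    exact (mem_torsionBy_iff (p : ℤ) _).1 ((φ : G ⧸ W → torsionBy ℤ B (p : ℤ)) y).2
  -- the inverse
  have hval : ∀ (ψ' : torsionBy ℤ (ρ.coindOpen W hW).toTopRep.ρ.invariants (p : ℤ)) (y : G ⧸ W),
      ((ψ' : (ρ.coindOpen W hW).toTopRep.ρ.invariants) : G ⧸ W → B) y ∈ torsionBy ℤ B (p : ℤ) :=
    fun ψ' y => by
    rw [mem_torsionBy_iff]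
    have h := (mem_torsionBy_iff (p : ℤ) _).1 ψ'.2
    have h' := congr_fun (congrArg (fun z : (ρ.coindOpen W hW).toTopRep.ρ.invariants =>
      (z : G ⧸ W → B)) h) y
    simpa only [coe_smul, Pi.smul_apply, coe_zero, Pi.zero_apply] using h'
  have hinv' : ∀ ψ' : torsionBy ℤ (ρ.coindOpen W hW).toTopRep.ρ.invariants (p : ℤ),
      (fun y => (⟨_, hval ψ' y⟩ : torsionBy ℤ B (p : ℤ))) ∈
        (ρp.coindOpen W hW).toTopRep.ρ.invariants := fun ψ' g => by
    funext y
    apply Subtype.ext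
    have h := congr_fun ((ψ' : (ρ.coindOpen W hW).toTopRep.ρ.invariants).2 g) y
    change ρ.coindOpen W hW g _ y = _ at h
    change ((ρp.coindOpen W hW g _ y : torsionBy ℤ B (p : ℤ)) : B) = _
    rw [coindOpen_apply_apply] at h ⊢
    exact h
  let e : (ρp.coindOpen W hW).toTopRep.ρ.invariants ≃ₗ[ℤ]
      torsionBy ℤ (ρ.coindOpen W hW).toTopRep.ρ.invariants (p : ℤ) :=
    { toFun := fun φ => ⟨⟨_, hinv φ⟩, htor φ⟩
      map_add' := fun _ _ => rfl
      map_smul' := fun _ _ => rfl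
      invFun := fun ψ' => ⟨_, hinv' ψ'⟩
      left_inv := fun _ => rfl
      right_inv := fun _ => rfl }
  refine additive_eq_of_linearEquiv ψ _ good_quot hψ' _ _
    ⟨‹_›, fun y => Subtype.ext (by
      rw [coe_smul, coe_zero]; exact (mem_torsionBy_iff _ _).1 y.2)⟩ e (fun c φ => ?_)
  rfl

/-- **`𝓗⁰(B)/p ≅ B^W/p` as `Δ`-modules** (`ψ`-form), `Δ` acting on `B^W` through
`ContinuousRep.quotientInvariants` (`φ ↦ φ(1)`, `coindOpenInvariantsEquiv_rep`).
[cite: SerreLocalFields1979, VII §5] [cite: NeukirchSchmidtWingberg2008, I §6 (induced modules)] -/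
theorem additive_coindOpenInvariantsRep_quotient
    [Finite ((ρ.invariantsOf W) ⧸ ((p : ℤ) • ⊤ : Submodule ℤ (ρ.invariantsOf W)))] :
    ψ ((ρ.coindOpenInvariantsRep W hW).quotient ((p : ℤ) • ⊤) (smul_top_le_comap _ (p : ℤ))) =
      ψ ((ρ.quotientInvariants W).toRepresentation.quotient ((p : ℤ) • ⊤)
        (smul_top_le_comap _ (p : ℤ))) :=
  Literature.RepresentationTheory.FiniteGroups.StableLatticeReduction.Int.additive_reduction_eq_of_linearEquiv
    ψ hψ _ _ (ρ.coindOpenInvariantsEquiv W hW) (fun c φ => ρ.coindOpenInvariantsEquiv_rep W hW c φ)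

/-- **`𝓗⁰(B)[p] ≅ B^W[p]` as `Δ`-modules** (`ψ`-form). [cite: SerreLocalFields1979, VII §5]
[cite: NeukirchSchmidtWingberg2008, I §6 (induced modules)] -/
theorem additive_coindOpenInvariantsRep_torsionBy_eq_invariantsOf
    [Finite (torsionBy ℤ (ρ.invariantsOf W) (p : ℤ))] :
    ψ ((ρ.coindOpenInvariantsRep W hW).subrepresentation
        (torsionBy ℤ (ρ.coindOpen W hW).toTopRep.ρ.invariants (p : ℤ)) (torsionBy_le_comap _ (p : ℤ))) =
      ψ ((ρ.quotientInvariants W).toRepresentation.subrepresentation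
        (torsionBy ℤ (ρ.invariantsOf W) (p : ℤ)) (torsionBy_le_comap _ (p : ℤ))) :=
  Poly.additive_subrepresentation_eq_of_linearEquiv ψ hψ _ _ _ _ _ _
    (ρ.coindOpenInvariantsEquiv W hW) (fun c φ => ρ.coindOpenInvariantsEquiv_rep W hW c φ)
    (fun φ => by rw [mem_torsionBy_iff, mem_torsionBy_iff, ← map_smul, LinearEquiv.map_eq_zero_iff])
    (fun y => Subtype.ext (by rw [coe_smul, coe_zero]; exact (mem_torsionBy_iff _ _).1 y.2))

end DegreeZero

end ContinuousRep

end Literature.NumberTheory.GaloisRepresentations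

end
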